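import Summits.ResolutionOfSingularities.ResolutionOfSingularities.Theorems.PurelyInseparableDim4SwapTransportWindowGluePrime
import HarnessLib
import HarnessLib.Audit.Tags

/-!
# Purely inseparable four-folds — THE REGIME-FREE TRANSPORT CORE of the virtual window FOR EVERY PRIME `p`: one real step
# (slot step or rotation) of a light-pair chain of order `p + 1` shadowed through the slot-unit class ℛ², for ANY polar-kernel
# rank `e_G`, with the virtual translation RETURNED (cell `res-dim4-pi`, K2(p) lane, rung-1 POWER-CONE LINE «light pair of
# TAIL(p, p−1, 3) ∀ p», window half W1; the `p = 5` instance is `…SwapTransportWindowCore`, p705139)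

[OURS · counted 0 · cell `res-dim4-pi` · K2(p) lane (holder res-dim4-p-12 g5, ruling g5-2 (6): the C∞-PRIME port, one
p-generic file at a time) · seat res-dim4-typ-1 g5.]  Nothing here proves K2(p) for any `p`, any TAIL(p, p−1, 3), any
TAIL(7, d, e), `NoIsolatedTrap p p` or resolution of singularities in dimension ≥ 4 / characteristic `p` — NOT proved.  AI kernel
work, weaker than expert review.  This file kills nothing: it is the transport step every window argument on the light pair of the
power-cone slots re-uses.

DICTIONARY against the `p = 5` file: `Step 5 ↦ Step p`, `ord₀ = 6 ↦ ord₀ = p + 1` (ledger `x_a x_{a′}` of weight `2`, shade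
`p − 1`; the newborn slot weight is `(p + 1) − p = 1`), precision loss `M − 5 ↦ M − p`, entry budget `Nc + 12 ≤ M ↦ Nc + 2p + 2 ≤ M`;
and ONE simplification: the `e_G`-transfer through the relation, carried BY VALUE at `5` (hypothesis `hEG` of `virtual_core_*`),
is DISCHARGED here by res-dim4-p-7 g4's p-generic `SwapNorm.finrank_resVertex_eq_of_slotUnit_rel₂` (tangent `IsUnit` from the free
`2 × 2` block by `isUnit_det_slotUnitClass₂`).
Glue (which slot a step leaves, `e_G` transfer): `…SwapTransportWindowGluePrime` (`step_cases_of_weights_prime`,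
`step_r_pair_of_slot`, `eG_transfer_prime`).
* §1 **`virtual_core_slot_prime`**, §2 **`virtual_core_rotate_prime`** — steps (1)–(7) of the `p = 5` core VERBATIM over the
  p-generic base transport (`unitFrame_step₂ (p)` p696827, `unitFrame_rotate₂ (p)` p697494, `read_of_rel₂ (p)` p698537, Cramer
  `exists_virtual_translation_step/rotate`, `det_after_step/rotate`, `forall_le_step_gen`): kept slot / rotation shape from the
  weights, the virtual translation `b′` off the slots, the transported frame with invertible free block, the relation at precision
  `M − p`, order `p + 1` and isolation of the translated virtual child `step p univ ℓ b′ B`, its ledger `x_a x_{a′} ∣ F`, and `e_G`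
  EQUAL to the real child's.  What a regime adds to get a PURE virtual step is only the pinning `b′ = 0`.
[cite: Hauser2010, §§F–G] [cite: CossartJannsenSaito2020, Thm. 3.14]
bears_on: LADDER-RESOLUTION:D157-DOOR2 (res-dim4-pi · K2(p) · power cones · re-presentation).  Supports
stmt-ResolutionOfSingularities-16155 (helper).
-/

set_option linter.dupNamespace false -- mandated namespace of this single-conjunct summit

noncomputable section

namespace Summit.ResolutionOfSingularities.ResolutionOfSingularities.Theorems.PIDim4

namespace SwapTransport

open MvPolynomial Finset
open Literature.AlgebraicGeometry.Resolution
open Literature.AlgebraicGeometry.Resolution.CentreBlowup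
open Literature.AlgebraicGeometry.Resolution.Hauser2010
open Literature.AlgebraicGeometry.Resolution.HauserPerlega2019

variable {K : Type} [Field K] [DecidableEq K]

/-! ## §1 Slot case -/

/-- **TRANSPORT CORE — SLOT CASE, every prime** (regime-free: any `e_G`; no frame; the virtual translation `b′` is RETURNED,
supported on the free letters; a regime-specific pinning lemma then shows `b′ = 0`).  REAL state `A` (ledger `x_{πλ} x_{πμ}`, order
`p + 1`) with its honest child `A′ = step p univ (π λ) b A` in the chart of the slot `π λ` (isolated with certificate level `Nc`,
order `p + 1`, `e_G = eG`, weights `≤ 1` of total `2`, `x^{r′} ∣ F′`); VIRTUAL state `B` (ledger `x_λ x_μ`, order `p + 1`,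
`x^r ∣ F`) related to `A` by a slot-unit-class frame `θ` along `π` at precision `M ≥ Nc + 2p + 2` with invertible free block.  THEN
`b (π μ) = 0`, `A′.r = x_{πλ} x_{πμ}`, and for the Cramer translation `b′` (off the slots) the child `step p univ λ b′ B` is related
to `A′` along `π` at precision `M − p` with invertible free block, has order `p + 1`, ledger `x_λ x_μ ∣ F`, is isolated, and has
`e_G = eG`. [OURS] [cite: Hauser2010, §§F–G] [cite: CossartJannsenSaito2020, Thm. 3.14] -/
theorem virtual_core_slot_prime (p : ℕ) [Fact p.Prime] [CharP K p] {π : Equiv.Perm (Fin 4)} {la mu u f : Fin 4}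
    (hlm : la ≠ mu) (hlu : la ≠ u) (hlf : la ≠ f) (hmu : mu ≠ u) (hmf : mu ≠ f) (huf : u ≠ f)
    -- the relation at precision `M`
    {A B : State K} {θ e : Fin 4 → MvPolynomial (Fin 4) K} {U E : MvPolynomial (Fin 4) K} {M : ℕ}
    (hθa : θ (π la) = X la * e la) (hθa' : θ (π mu) = X mu * e mu) (hea : constantCoeff (e la) ≠ 0)
    (hea' : constantCoeff (e mu) ≠ 0) (hu0 : constantCoeff (θ (π u)) = 0) (hf0 : constantCoeff (θ (π f)) = 0)
    (hdet : coeff (Finsupp.single u 1) (θ (π u)) * coeff (Finsupp.single f 1) (θ (π f)) -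
      coeff (Finsupp.single f 1) (θ (π u)) * coeff (Finsupp.single u 1) (θ (π f)) ≠ 0)
    (hU : constantCoeff U ≠ 0) (hE : E ∈ originIdeal K ^ M) (hrel : B.F = deletePthPowers p (U ^ p * aeval θ A.F) + E)
    -- the real state and its honest slot step
    (hoA : ordZero A.F = ((p + 1 : ℕ) : ℕ∞)) (hrA : A.r = Finsupp.single (π la) 1 + Finsupp.single (π mu) 1) {A' : State K}
    {b : Fin 4 → K} (hbj : b (π la) = 0) (hstep : A' = CentreBlowup.step p Finset.univ (π la) b A)
    (hisoA' : IsIsolated p A'.F) {Nc : ℕ} (hcert : originIdeal K ^ Nc ≤ singLocusIdeal p A'.F ⊔ originIdeal K ^ (Nc + 1))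
    (hoA' : ordZero A'.F = ((p + 1 : ℕ) : ℕ∞)) {eG : ℕ} (he3A' : Module.finrank K (ResCone.resVertex A') = eG)
    (hw1 : ∀ i, A'.r i ≤ 1) (hdegA' : A'.r.degree = 2) (hdivA' : ∀ d ∈ A'.F.support, A'.r ≤ d)
    -- the virtual state
    (hoB : ordZero B.F = ((p + 1 : ℕ) : ℕ∞)) (hrB : B.r = Finsupp.single la 1 + Finsupp.single mu 1)
    (hdivB : ∀ d ∈ B.F.support, B.r ≤ d) (hM : Nc + 2 * p + 2 ≤ M) :
    b (π mu) = 0 ∧ A'.r = Finsupp.single (π la) 1 + Finsupp.single (π mu) 1 ∧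
    ∃ (b' : Fin 4 → K) (θ' e' : Fin 4 → MvPolynomial (Fin 4) K) (U' E' : MvPolynomial (Fin 4) K),
      b' la = 0 ∧ b' mu = 0 ∧
      θ' (π la) = X la * e' la ∧ θ' (π mu) = X mu * e' mu ∧ constantCoeff (e' la) ≠ 0 ∧ constantCoeff (e' mu) ≠ 0 ∧
      constantCoeff (θ' (π u)) = 0 ∧ constantCoeff (θ' (π f)) = 0 ∧
      coeff (Finsupp.single u 1) (θ' (π u)) * coeff (Finsupp.single f 1) (θ' (π f)) -
        coeff (Finsupp.single f 1) (θ' (π u)) * coeff (Finsupp.single u 1) (θ' (π f)) ≠ 0 ∧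
      constantCoeff U' ≠ 0 ∧ E' ∈ originIdeal K ^ (M - p) ∧
      (CentreBlowup.step p Finset.univ la b' B).F = deletePthPowers p (U' ^ p * aeval θ' A'.F) + E' ∧
      ordZero (CentreBlowup.step p Finset.univ la b' B).F = ((p + 1 : ℕ) : ℕ∞) ∧
      (CentreBlowup.step p Finset.univ la b' B).r = Finsupp.single la 1 + Finsupp.single mu 1 ∧
      (∀ d ∈ (CentreBlowup.step p Finset.univ la b' B).F.support, (CentreBlowup.step p Finset.univ la b' B).r ≤ d) ∧
      IsIsolated p (CentreBlowup.step p Finset.univ la b' B).F ∧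
      Module.finrank K (ResCone.resVertex (CentreBlowup.step p Finset.univ la b' B)) = eG := by
  have hp1 : 1 < p := (Fact.out : p.Prime).one_lt
  have hπlm : π la ≠ π mu := fun h => hlm (π.injective h)
  have hπlu : π la ≠ π u := fun h => hlu (π.injective h)
  have hπlf : π la ≠ π f := fun h => hlf (π.injective h)
  have hπmu : π mu ≠ π u := fun h => hmu (π.injective h)
  have hπmf : π mu ≠ π f := fun h => hmf (π.injective h)
  have hπuf : π u ≠ π f := fun h => huf (π.injective h)
  -- (1) the kept slot: `b (π mu) = 0`, `A′.r = x_{πλ} x_{πμ}`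
  have hw1' : ∀ i, (CentreBlowup.step p Finset.univ (π la) b A).r i ≤ 1 := fun i => by rw [← hstep]; exact hw1 i
  have hdeg' : (CentreBlowup.step p Finset.univ (π la) b A).r.degree = 2 := by rw [← hstep]; exact hdegA'
  have hkept : b (π mu) = 0 ∧ A'.r = Finsupp.single (π la) 1 + Finsupp.single (π mu) 1 := by
    rcases step_cases_of_weights_prime p hπlm hπlu hπlf hπmu hπmf hπuf hrA hoA (jr := π la) hw1' hdeg' with
      ⟨-, hb, hr⟩ | ⟨h, -⟩ | ⟨h, -⟩
    · exact ⟨hb, by rw [hstep, hr]⟩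
    · exact absurd h hπlm
    · rcases h with h | h
      · exact absurd h hπlu
      · exact absurd h hπlf
  obtain ⟨hbmu, hrA'⟩ := hkept
  -- (2) the class hypotheses in `∀ i ∉ {u, f}` form
  have hslots : ∀ i : Fin 4, i ≠ u → i ≠ f → i = la ∨ i = mu := by
    intro i hiu hif
    rcases ResCone.letters_exhaust hlm hlu hlf hmu hmf huf i with h | h | h | h
    · exact Or.inl h
    · exact Or.inr h
    · exact absurd h hiu
    · exact absurd h hif
  have hθi : ∀ i, i ≠ u → i ≠ f → θ (π i) = X i * e i := by
    intro i hiu hif; rcases hslots i hiu hif with rfl | rfl <;> assumption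
  have he : ∀ i, i ≠ u → i ≠ f → constantCoeff (e i) ≠ 0 := by
    intro i hiu hif; rcases hslots i hiu hif with rfl | rfl <;> assumption
  have hbi : ∀ i, i ≠ u → i ≠ f → b (π i) = 0 := by
    intro i hiu hif; rcases hslots i hiu hif with rfl | rfl <;> assumption
  -- (3) Cramer: the virtual translation
  obtain ⟨b', hb'i, hγu, hγf⟩ := exists_virtual_translation_step (π := π) (θ := θ) (e := e) la huf b hdet
  have hA5 : ((p : ℕ) : ℕ∞) ≤ ordAlong Finset.univ A.F := by
    rw [ordAlong_univ, hoA]; exact_mod_cast (by omega : p ≤ p + 1)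
  have hB5 : ((p : ℕ) : ℕ∞) ≤ ordAlong Finset.univ B.F := by
    rw [ordAlong_univ, hoB]; exact_mod_cast (by omega : p ≤ p + 1)
  -- (4) transport
  obtain ⟨θ', e', U', E', w, hθ'i, he', hu0', hf0', hU', hE', hrel', hwc, -, -, hlinu, hlinf⟩ :=
    unitFrame_step₂ p π huf hθi he hu0 hf0 hU hE hrel hA5 hB5 hlu hlf hbi hb'i hγu hγf
  rw [← hstep] at hrel'
  have hwne : w ≠ 0 := left_ne_zero_of_mul_eq_one hwc
  -- (5) the new free block is invertible
  have hdet' : coeff (Finsupp.single u 1) (θ' (π u)) * coeff (Finsupp.single f 1) (θ' (π f)) -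
      coeff (Finsupp.single f 1) (θ' (π u)) * coeff (Finsupp.single u 1) (θ' (π f)) ≠ 0 := by
    rw [det_after_step hlu hlf hlinu hlinf]
    exact mul_ne_zero (pow_ne_zero 2 hwne) hdet
  -- (6) order and isolation of the virtual child
  have hread := read_of_rel₂ p hlm hlu hlf hmu hmf huf (hθ'i la hlu hlf) (hθ'i mu hmu hmf) (he' la hlu hlf)
    (he' mu hmu hmf) hu0' hf0' hdet' hU' hE' hrel' hisoA' hcert (by omega) (o := p + 1) hoA'
    (not_dvd_succ_of_prime (Fact.out)) (by omega)
  have hisoBp : IsIsolated p (CentreBlowup.step p Finset.univ la b' B).F := hread.1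
  have hoBp : ordZero (CentreBlowup.step p Finset.univ la b' B).F = ((p + 1 : ℕ) : ℕ∞) := hread.2
  -- (7) ledger and divisibility of the virtual child, then `e_G` by the transfer
  have hb'la : b' la = 0 := hb'i la hlu hlf
  have hb'mu : b' mu = 0 := hb'i mu hmu hmf
  have hrBp : (CentreBlowup.step p Finset.univ la b' B).r = Finsupp.single la 1 + Finsupp.single mu 1 :=
    step_r_pair_of_slot p hlm hlu hlf hmu hmf huf hrB hoB hb'mu
  have hdivBp : ∀ d ∈ (CentreBlowup.step p Finset.univ la b' B).F.support, (CentreBlowup.step p Finset.univ la b' B).r ≤ d :=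
    forall_le_step_gen B hdivB la hb'la
  have he3Bp : Module.finrank K (ResCone.resVertex (CentreBlowup.step p Finset.univ la b' B)) = eG := by
    rw [eG_transfer_prime p hlm hlu hlf hmu hmf huf (A := A') (B := CentreBlowup.step p Finset.univ la b' B) (hθ'i la hlu hlf)
      (hθ'i mu hmu hmf) (he' la hlu hlf) (he' mu hmu hmf) hu0' hf0' hdet' hU' hE' hrel' hrA' hrBp hdivA' hoA' (by omega)]
    exact he3A'
  exact ⟨hbmu, hrA', b', θ', e', U', E', hb'la, hb'mu, hθ'i la hlu hlf, hθ'i mu hmu hmf, he' la hlu hlf, he' mu hmu hmf, hu0', hf0',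
    hdet', hU', hE', hrel', hoBp, hrBp, hdivBp, hisoBp, he3Bp⟩

/-! ## §2 Rotation case -/

/-- **TRANSPORT CORE — ROTATION CASE, every prime** (regime-free; the virtual translation `b′` off the slots is RETURNED).  The real
chain steps in the chart of a FREE letter `π g` translating the slot `π a` away (`b (π a) ≠ 0`, `b (π a′) = 0`, child ledger
`x_{πg} x_{πa′}`); the virtual partner steps in the chart of `a` and the bijection becomes `π′ = π ∘ (a g)`. [OURS]
[cite: Hauser2010, §§F–G] [cite: CossartJannsenSaito2020, Thm. 3.14] -/
theorem virtual_core_rotate_prime (p : ℕ) [Fact p.Prime] [CharP K p] {π : Equiv.Perm (Fin 4)} {a a' u f g gt : Fin 4}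
    (haa' : a ≠ a') (hau : a ≠ u) (haf : a ≠ f) (ha'u : a' ≠ u) (ha'f : a' ≠ f) (huf : u ≠ f)
    (hg : (g = u ∧ gt = f) ∨ (g = f ∧ gt = u))
    -- the relation at precision `M`
    {A B : State K} {θ e : Fin 4 → MvPolynomial (Fin 4) K} {U E : MvPolynomial (Fin 4) K} {M : ℕ}
    (hθa : θ (π a) = X a * e a) (hθa' : θ (π a') = X a' * e a') (hea : constantCoeff (e a) ≠ 0)
    (hea' : constantCoeff (e a') ≠ 0) (hu0 : constantCoeff (θ (π u)) = 0) (hf0 : constantCoeff (θ (π f)) = 0)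
    (hdet : coeff (Finsupp.single u 1) (θ (π u)) * coeff (Finsupp.single f 1) (θ (π f)) -
      coeff (Finsupp.single f 1) (θ (π u)) * coeff (Finsupp.single u 1) (θ (π f)) ≠ 0)
    (hU : constantCoeff U ≠ 0) (hE : E ∈ originIdeal K ^ M) (hrel : B.F = deletePthPowers p (U ^ p * aeval θ A.F) + E)
    -- the real state and its honest rotation step
    (hoA : ordZero A.F = ((p + 1 : ℕ) : ℕ∞)) {A' : State K} {b : Fin 4 → K} (hbj : b (π g) = 0) (hba : b (π a) ≠ 0)
    (hba' : b (π a') = 0) (hstep : A' = CentreBlowup.step p Finset.univ (π g) b A)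
    (hisoA' : IsIsolated p A'.F) {Nc : ℕ} (hcert : originIdeal K ^ Nc ≤ singLocusIdeal p A'.F ⊔ originIdeal K ^ (Nc + 1))
    (hoA' : ordZero A'.F = ((p + 1 : ℕ) : ℕ∞)) {eG : ℕ} (he3A' : Module.finrank K (ResCone.resVertex A') = eG)
    (hrA' : A'.r = Finsupp.single (π g) 1 + Finsupp.single (π a') 1) (hdivA' : ∀ d ∈ A'.F.support, A'.r ≤ d)
    -- the virtual state
    (hoB : ordZero B.F = ((p + 1 : ℕ) : ℕ∞)) (hrB : B.r = Finsupp.single a 1 + Finsupp.single a' 1)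
    (hdivB : ∀ d ∈ B.F.support, B.r ≤ d) (hM : Nc + 2 * p + 2 ≤ M) :
    ∃ (π' : Equiv.Perm (Fin 4)) (b' : Fin 4 → K) (θ' e' : Fin 4 → MvPolynomial (Fin 4) K) (U' E' : MvPolynomial (Fin 4) K),
      π' = (Equiv.swap a g).trans π ∧ π' a = π g ∧ π' a' = π a' ∧ π' g = π a ∧ π' gt = π gt ∧ b' a = 0 ∧ b' a' = 0 ∧
      θ' (π' a) = X a * e' a ∧ θ' (π' a') = X a' * e' a' ∧ constantCoeff (e' a) ≠ 0 ∧ constantCoeff (e' a') ≠ 0 ∧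
      constantCoeff (θ' (π' u)) = 0 ∧ constantCoeff (θ' (π' f)) = 0 ∧
      coeff (Finsupp.single u 1) (θ' (π' u)) * coeff (Finsupp.single f 1) (θ' (π' f)) -
        coeff (Finsupp.single f 1) (θ' (π' u)) * coeff (Finsupp.single u 1) (θ' (π' f)) ≠ 0 ∧
      constantCoeff U' ≠ 0 ∧ E' ∈ originIdeal K ^ (M - p) ∧
      (CentreBlowup.step p Finset.univ a b' B).F = deletePthPowers p (U' ^ p * aeval θ' A'.F) + E' ∧
      ordZero (CentreBlowup.step p Finset.univ a b' B).F = ((p + 1 : ℕ) : ℕ∞) ∧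
      (CentreBlowup.step p Finset.univ a b' B).r = Finsupp.single a 1 + Finsupp.single a' 1 ∧
      (∀ d ∈ (CentreBlowup.step p Finset.univ a b' B).F.support, (CentreBlowup.step p Finset.univ a b' B).r ≤ d) ∧
      IsIsolated p (CentreBlowup.step p Finset.univ a b' B).F ∧
      Module.finrank K (ResCone.resVertex (CentreBlowup.step p Finset.univ a b' B)) = eG := by
  have hp1 : 1 < p := (Fact.out : p.Prime).one_lt
  -- (1) the free letters `g, g̃`
  have hag : a ≠ g := by rcases hg with ⟨rfl, -⟩ | ⟨rfl, -⟩ <;> assumption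
  have hagt : a ≠ gt := by rcases hg with ⟨-, rfl⟩ | ⟨-, rfl⟩ <;> assumption
  have ha'g : a' ≠ g := by rcases hg with ⟨rfl, -⟩ | ⟨rfl, -⟩ <;> assumption
  have ha'gt : a' ≠ gt := by rcases hg with ⟨-, rfl⟩ | ⟨-, rfl⟩ <;> assumption
  have hggt : g ≠ gt := by
    rcases hg with ⟨rfl, rfl⟩ | ⟨rfl, rfl⟩
    · exact huf
    · exact huf.symm
  have hg0 : constantCoeff (θ (π g)) = 0 := by rcases hg with ⟨rfl, -⟩ | ⟨rfl, -⟩ <;> assumption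
  have hgt0 : constantCoeff (θ (π gt)) = 0 := by rcases hg with ⟨-, rfl⟩ | ⟨-, rfl⟩ <;> assumption
  have hdetg : coeff (Finsupp.single g 1) (θ (π g)) * coeff (Finsupp.single gt 1) (θ (π gt)) -
      coeff (Finsupp.single gt 1) (θ (π g)) * coeff (Finsupp.single g 1) (θ (π gt)) ≠ 0 := by
    rcases hg with ⟨rfl, rfl⟩ | ⟨rfl, rfl⟩
    · exact hdet
    · exact fun h => hdet (by linear_combination h)
  have hA5 : ((p : ℕ) : ℕ∞) ≤ ordAlong Finset.univ A.F := by
    rw [ordAlong_univ, hoA]; exact_mod_cast (by omega : p ≤ p + 1)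
  have hB5 : ((p : ℕ) : ℕ∞) ≤ ordAlong Finset.univ B.F := by
    rw [ordAlong_univ, hoB]; exact_mod_cast (by omega : p ≤ p + 1)
  -- (2) Cramer: the virtual translation and the rescaling `λ`
  obtain ⟨lam, b', hb'a, hb'a', hLa, hLg, hLgt⟩ :=
    exists_virtual_translation_rotate (π := π) (θ := θ) (e := e) hag hagt ha'g ha'gt hggt b hba hdetg
  have hlam : lam ≠ 0 := by
    intro h; rw [h, zero_mul] at hLa; exact hea hLa.symm
  -- (3) transport across the two charts
  obtain ⟨θ', e', U', E', hθ'g, hθ'a', he'a, he'a', ha0', hgt0', hU', hE', hrel', -, -, htana, htangt⟩ :=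
    unitFrame_rotate₂ p π haa' hag hagt ha'g ha'gt hggt (M := M) (by omega) hθa hθa' hea hea' hg0 hgt0 hU hE hrel hA5 hB5
      hbj hba' hb'a hb'a' hLa hLg hLgt
  rw [← hstep] at hrel'
  -- (4) the new free block is invertible
  have hD'g : coeff (Finsupp.single g 1) (θ' (π a)) * coeff (Finsupp.single gt 1) (θ' (π gt)) -
      coeff (Finsupp.single gt 1) (θ' (π a)) * coeff (Finsupp.single g 1) (θ' (π gt)) ≠ 0 := by
    intro h0
    have h := det_after_rotate hag hagt (σ := b (π gt)) hlam htana htangt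
    rw [h0, mul_zero] at h
    exact mul_ne_zero hea hdetg (neg_eq_zero.mp h.symm)
  -- (5) the new bijection `π′ = π ∘ (a g)`
  obtain ⟨π', hπ'⟩ : ∃ π' : Equiv.Perm (Fin 4), π' = (Equiv.swap a g).trans π := ⟨_, rfl⟩
  have hπ'a : π' a = π g := by rw [hπ', Equiv.trans_apply, Equiv.swap_apply_left]
  have hπ'g : π' g = π a := by rw [hπ', Equiv.trans_apply, Equiv.swap_apply_right]
  have hπ'a' : π' a' = π a' := by rw [hπ', Equiv.trans_apply, Equiv.swap_apply_of_ne_of_ne haa'.symm ha'g]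
  have hπ'gt : π' gt = π gt := by rw [hπ', Equiv.trans_apply, Equiv.swap_apply_of_ne_of_ne hagt.symm hggt.symm]
  have hθn : θ' (π' a) = X a * e' a := by rw [hπ'a]; exact hθ'g
  have hθn' : θ' (π' a') = X a' * e' a' := by rw [hπ'a']; exact hθ'a'
  have hu0n : constantCoeff (θ' (π' u)) = 0 := by
    rcases hg with ⟨rfl, rfl⟩ | ⟨rfl, rfl⟩
    · rw [hπ'g]; exact ha0'
    · rw [hπ'gt]; exact hgt0'
  have hf0n : constantCoeff (θ' (π' f)) = 0 := by
    rcases hg with ⟨rfl, rfl⟩ | ⟨rfl, rfl⟩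
    · rw [hπ'gt]; exact hgt0'
    · rw [hπ'g]; exact ha0'
  have hdetn : coeff (Finsupp.single u 1) (θ' (π' u)) * coeff (Finsupp.single f 1) (θ' (π' f)) -
      coeff (Finsupp.single f 1) (θ' (π' u)) * coeff (Finsupp.single u 1) (θ' (π' f)) ≠ 0 := by
    rcases hg with ⟨rfl, rfl⟩ | ⟨rfl, rfl⟩
    · rw [hπ'g, hπ'gt]; exact hD'g
    · rw [hπ'g, hπ'gt]; exact fun h => hD'g (by linear_combination h)
  have hrAn : A'.r = Finsupp.single (π' a) 1 + Finsupp.single (π' a') 1 := by rw [hπ'a, hπ'a']; exact hrA'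
  -- (6) order and isolation of the virtual child
  have hread := read_of_rel₂ p haa' hau haf ha'u ha'f huf hθn hθn' he'a he'a' hu0n hf0n hdetn hU' hE' hrel' hisoA' hcert
    (by omega) (o := p + 1) hoA' (not_dvd_succ_of_prime (Fact.out)) (by omega)
  have hisoBp : IsIsolated p (CentreBlowup.step p Finset.univ a b' B).F := hread.1
  have hoBp : ordZero (CentreBlowup.step p Finset.univ a b' B).F = ((p + 1 : ℕ) : ℕ∞) := hread.2
  -- (7) ledger and divisibility of the virtual child, then `e_G` by the transfer
  have hrBp : (CentreBlowup.step p Finset.univ a b' B).r = Finsupp.single a 1 + Finsupp.single a' 1 :=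
    step_r_pair_of_slot p haa' hau haf ha'u ha'f huf hrB hoB hb'a'
  have hdivBp : ∀ d ∈ (CentreBlowup.step p Finset.univ a b' B).F.support, (CentreBlowup.step p Finset.univ a b' B).r ≤ d :=
    forall_le_step_gen B hdivB a hb'a
  have he3Bp : Module.finrank K (ResCone.resVertex (CentreBlowup.step p Finset.univ a b' B)) = eG := by
    rw [eG_transfer_prime p haa' hau haf ha'u ha'f huf (π := π') (A := A') (B := CentreBlowup.step p Finset.univ a b' B) hθn hθn'
      he'a he'a' hu0n hf0n hdetn hU' hE' hrel' hrAn hrBp hdivA' hoA' (by omega)]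
    exact he3A'
  exact ⟨π', b', θ', e', U', E', hπ', hπ'a, hπ'a', hπ'g, hπ'gt, hb'a, hb'a', hθn, hθn', he'a, he'a', hu0n, hf0n, hdetn, hU',
    hE', hrel', hoBp, hrBp, hdivBp, hisoBp, he3Bp⟩

end SwapTransport

end Summit.ResolutionOfSingularities.ResolutionOfSingularities.Theorems.PIDim4

end
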